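import Summits.QuantumFields.QCD.Theses.PauliWegnerSea
import Summits.QuantumFields.QCD.Theorems.TiltedFlatness.Negative.TwoWellFloor
import Literature.MathematicalPhysics.QuantumFieldTheory.StrongCouplingActivities
import Literature.MathematicalPhysics.QuantumFieldTheory.QCDPhaseQuenched

/-!
# Crux `TiltedFlatness` (stmt-QuantumFields-14070), line `circle-transport` — stub `stub_circleUntilt`

THE UNTILT (ball-free density bound).  For a one-parameter family `T : ℝ → SU(3)` with matrix form
`diag(e^{iθ}, e^{-iθ}, 1)` and a FIXED surjective word `g = Π_j V_j T(s_j) V_j⁻¹` of conjugated circles,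
every continuous "action" `S` on `SU(3)^E` that depends on at most `n` listed coordinates `r : ι → E`
and is `K`-Lipschitz along every two-sided circle `s ↦ W[r i ↦ A T(s) B]` has a tilted law
`e^{-βS} Haar^{⊗E} / Z` of density `≤ C (1+β)^p` against product Haar, with `C, p` depending only on
`n, K` (and the word), not on `E, ι, S, β, W`.

Proof ("untilt": no Haar-ball volumes, no Weyl formula).  The matrix form makes `T` continuous and
`2π`-periodic, so word angles may be taken in `[-π, π]`.  For angles `θ : ι × Fin d → ℝ` let
`g_θ ∈ SU(3)^E` carry at every listed coordinate `e = r i₀` (`i₀` a chosen preimage) the word with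
angles `θ (i₀, ·)`, and `1` elsewhere.  Left invariance of product Haar and Tonelli give the coupling
`Leb(box) · Z = ∫ ∫_{box} e^{-βS(g_θ W')} dθ dHaar(W')`, `box = [-π,π]^{ι × Fin d}` (`le_lintegral_of_fibre`).
Every fibre reaches a GLOBAL minimiser `W₁` of `S` (compactness + surjectivity of the word + dependence
on the listed coordinates): `S(g_{θ⋆} W') = S_min` for some `θ⋆ ∈ box`; and `θ ↦ S(g_θ W')` is
`K`-Lipschitz in each angle (one angle = one move `A T(s) B` at one listed coordinate,
`prod_ofFn_update`), hence `ℓ¹`-Lipschitz (`abs_sub_le_mul_sum`).  On a cube of side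
`h = 1/(π⁻¹ + (β+1)K(m+1))` at `θ⋆` inside the box the integrand is `≥ e^{-βS_min-1}`
(`cube_lintegral_bound`), so `Z ≥ e^{-βS_min-1} (h/2π)^m`, `m = #ι · d ≤ nd`, while
`e^{-βS(W)} ≤ e^{-βS_min}`: the density is `≤ e (2π/h)^m ≤ e (2+2πK(nd+1))^{nd} (1+β)^{nd}`.
Sources: folklore (Haar averaging along one-parameter subgroups); line card `circle-transport` §5.
-/

noncomputable section

namespace Summit.QuantumFields.QCD.Theorems.CircleTransport

open scoped BigOperators Real Matrix.Norms.L2Operator ENNReal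
open MeasureTheory Set Filter
open Literature.MathematicalPhysics.QuantumFieldTheory Literature.MathematicalPhysics.QuantumLattice
  Literature.Probability.LatticeModels

/-- `SU(3)` (the tree's `Matrix.specialUnitaryGroup (Fin 3) ℂ`). -/
local notation "SU3" => Matrix.specialUnitaryGroup (Fin 3) ℂ

/-- Splitting an ordered product at one factor: the product of `List.ofFn (update f j y)` is
`A * y * B` with `A`, `B` independent of `y`. -/
private theorem prod_ofFn_update {G : Type*} [Monoid G] :
    ∀ (d : ℕ) (f : Fin d → G) (j : Fin d), ∃ A B : G, ∀ y : G,
      (List.ofFn (Function.update f j y)).prod = A * y * B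
  | 0, _, j => j.elim0
  | d + 1, f, j => by
    obtain rfl | ⟨j', rfl⟩ := Fin.eq_zero_or_eq_succ j
    · refine ⟨1, (List.ofFn fun i : Fin d => f i.succ).prod, fun y => ?_⟩
      have h1 : (fun i : Fin d => Function.update f 0 y i.succ) = fun i => f i.succ :=
        funext fun i => Function.update_of_ne (Fin.succ_ne_zero i) _ _
      rw [List.ofFn_succ, List.prod_cons, Function.update_self, h1, one_mul]
    · obtain ⟨A, B, hAB⟩ := prod_ofFn_update d (fun i : Fin d => f i.succ) j'
      refine ⟨f 0 * A, B, fun y => ?_⟩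
      rw [List.ofFn_succ, List.prod_cons, Function.update_of_ne (Fin.succ_ne_zero j').symm,
        Function.update_comp_eq_of_injective' f (Fin.succ_injective d) j' y, hAB]
      simp only [mul_assoc]

/-- Lipschitz in each coordinate separately implies `ℓ¹`-Lipschitz. -/
private theorem abs_sub_le_mul_sum {κ : Type*} [Fintype κ] [DecidableEq κ] (g : (κ → ℝ) → ℝ)
    {L : ℝ} (hL : ∀ θ k s, |g (Function.update θ k s) - g θ| ≤ L * |s - θ k|) (θ θ' : κ → ℝ) :
    |g θ - g θ'| ≤ L * ∑ k, |θ k - θ' k| := by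
  suffices H : ∀ s : Finset κ,
      |g (fun k => if k ∈ s then θ k else θ' k) - g θ'| ≤ L * ∑ k ∈ s, |θ k - θ' k| by
    simpa using H Finset.univ
  intro s
  induction s using Finset.induction_on with
  | empty => simp
  | @insert a s ha ih =>
    have hstep : (fun k => if k ∈ insert a s then θ k else θ' k) =
        Function.update (fun k => if k ∈ s then θ k else θ' k) a (θ a) := by
      funext k
      by_cases hk : k = a
      · subst hk; rw [Function.update_self]; simp
      · rw [Function.update_of_ne hk]; simp [Finset.mem_insert, hk]
    have h1 := hL (fun k => if k ∈ s then θ k else θ' k) a (θ a)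
    rw [if_neg ha] at h1
    rw [hstep, Finset.sum_insert ha, mul_add]
    exact (abs_sub_le _ (g fun k => if k ∈ s then θ k else θ' k) _).trans (add_le_add h1 ih)

/-- A family with the matrix form `diag(e^{iθ}, e^{-iθ}, 1)` is continuous. -/
private theorem continuous_of_coe_eq (T : ℝ → SU3)
    (hT : ∀ θ : ℝ, ((T θ : SU3) : Matrix (Fin 3) (Fin 3) ℂ) =
      Matrix.diagonal ![Complex.exp (θ * Complex.I), Complex.exp (-(θ * Complex.I)), 1]) :
    Continuous T := by
  refine continuous_induced_rng.2 ?_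
  have : ((↑) ∘ T : ℝ → Matrix (Fin 3) (Fin 3) ℂ) = fun θ : ℝ =>
      Matrix.diagonal
        ![Complex.exp ((θ : ℂ) * Complex.I), Complex.exp (-((θ : ℂ) * Complex.I)), 1] :=
    funext hT
  rw [this]
  refine Continuous.matrix_diagonal (continuous_pi fun i => ?_)
  fin_cases i <;> simp <;> fun_prop

/-- A family with the matrix form `diag(e^{iθ}, e^{-iθ}, 1)` is `2π`-periodic. -/
private theorem periodic_of_coe_eq (T : ℝ → SU3)
    (hT : ∀ θ : ℝ, ((T θ : SU3) : Matrix (Fin 3) (Fin 3) ℂ) =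
      Matrix.diagonal ![Complex.exp (θ * Complex.I), Complex.exp (-(θ * Complex.I)), 1]) :
    Function.Periodic T (2 * π) := by
  intro x
  apply Subtype.ext
  have h1 : Complex.exp (((x + 2 * π : ℝ) : ℂ) * Complex.I) = Complex.exp (x * Complex.I) := by
    push_cast
    rw [add_mul, Complex.exp_add, Complex.exp_two_pi_mul_I, mul_one]
  have h2 : Complex.exp (-(((x + 2 * π : ℝ) : ℂ) * Complex.I)) =
      Complex.exp (-(x * Complex.I)) := by
    push_cast
    rw [add_mul, neg_add, Complex.exp_add, Complex.exp_neg (2 * π * Complex.I),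
      Complex.exp_two_pi_mul_I, inv_one, mul_one]
  rw [hT, hT, h1, h2]

/-- The word coupling: if for every point the fibre average of `F` along the left translates
`g θ * x` is at least `c`, then `c ≤ ν(univ) · ∫ F dμ` (left invariance + Tonelli). -/
private theorem le_lintegral_of_fibre {X P : Type*} [MeasurableSpace X] [Group X]
    [MeasurableMul X] (μ : Measure X) [μ.IsMulLeftInvariant] [IsProbabilityMeasure μ]
    [MeasurableSpace P] (ν : Measure P) [SFinite ν] (g : P → X) (F : X → ℝ≥0∞)
    (hF : Measurable fun p : P × X => F (g p.1 * p.2)) (c : ℝ≥0∞)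
    (hc : ∀ x, c ≤ ∫⁻ θ, F (g θ * x) ∂ν) : c ≤ ν univ * ∫⁻ x, F x ∂μ := by
  calc c = ∫⁻ _x, c ∂μ := by rw [lintegral_const, measure_univ, mul_one]
    _ ≤ ∫⁻ x, ∫⁻ θ, F (g θ * x) ∂ν ∂μ := lintegral_mono fun x => hc x
    _ = ∫⁻ θ, ∫⁻ x, F (g θ * x) ∂μ ∂ν :=
        lintegral_lintegral_swap (f := fun x θ => F (g θ * x))
          (hF.comp measurable_swap).aemeasurable
    _ = ∫⁻ _θ, ∫⁻ x, F x ∂μ ∂ν := lintegral_congr fun θ => lintegral_mul_left_eq_self _ _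
    _ = ν univ * ∫⁻ x, F x ∂μ := by rw [lintegral_const, mul_comm]

/-- Cube lower bound on the angle box: if `f ≥ c` on the sup-cube of side `h ≤ π` around a point
`θ⋆` of the box `[-π,π]^κ`, then `h^{#κ} · c ≤ ∫_{box} f`. -/
private theorem cube_lintegral_bound {κ : Type*} [Fintype κ] (θs : κ → ℝ)
    (hθs : θs ∈ Icc (fun _ : κ => -π) (fun _ => π)) {h : ℝ} (h0 : 0 < h) (hπ : h ≤ π)
    (f : (κ → ℝ) → ℝ≥0∞) (hf : Measurable f) (c : ℝ≥0∞)
    (hfc : ∀ θ : κ → ℝ, (∀ k, |θ k - θs k| ≤ h) → c ≤ f θ) :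
    ENNReal.ofReal (h ^ Fintype.card κ) * c ≤ ∫⁻ θ in Icc (fun _ : κ => -π) (fun _ => π), f θ := by
  set a : κ → ℝ := fun k => if θs k ≤ 0 then θs k else θs k - h with ha
  have hQsub : Icc a (fun k => a k + h) ⊆ Icc (fun _ : κ => -π) (fun _ => π) := by
    intro θ hθ
    refine ⟨fun k => ?_, fun k => ?_⟩
    · have h1 := hθ.1 k; have h2 := hθs.1 k
      simp only [ha] at h1
      split_ifs at h1 with hk <;> linarith
    · have h1 := hθ.2 k; have h2 := hθs.2 k
      simp only [ha] at h1
      split_ifs at h1 with hk <;> linarith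
  have hQnear : ∀ θ ∈ Icc a (fun k => a k + h), ∀ k, |θ k - θs k| ≤ h := by
    intro θ hθ k
    have h1 := hθ.1 k; have h2 := hθ.2 k
    simp only [ha] at h1 h2
    rw [abs_sub_le_iff]
    split_ifs at h1 h2 with hk <;> constructor <;> linarith
  have hvol : volume (Icc a (fun k => a k + h)) = ENNReal.ofReal (h ^ Fintype.card κ) := by
    rw [Real.volume_Icc_pi]
    simp only [add_sub_cancel_left, Finset.prod_const, Finset.card_univ]
    rw [ENNReal.ofReal_pow h0.le]
  calc ENNReal.ofReal (h ^ Fintype.card κ) * c = ∫⁻ _θ in Icc a (fun k => a k + h), c := by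
        rw [setLIntegral_const, hvol, mul_comm]
    _ ≤ ∫⁻ θ in Icc a (fun k => a k + h), f θ :=
        setLIntegral_mono hf fun θ hθ => hfc θ (hQnear θ hθ)
    _ ≤ ∫⁻ θ in Icc (fun _ : κ => -π) (fun _ => π), f θ := lintegral_mono_set hQsub

/-- STUB 7 (THE UNTILT, size M): a surjective word gives the ball-free density bound `FibreDensity`. -/
theorem stub_circleUntilt : ∀ T : ℝ → SU3,
    (∀ θ : ℝ, ((T θ : SU3) : Matrix (Fin 3) (Fin 3) ℂ) =
      Matrix.diagonal ![Complex.exp (θ * Complex.I), Complex.exp (-(θ * Complex.I)), 1]) →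
    (∃ (d : ℕ) (V : Fin d → SU3), ∀ g : SU3, ∃ s : Fin d → ℝ,
      g = (List.ofFn fun j => V j * T (s j) * (V j)⁻¹).prod) →
    ∀ (n : ℕ) (K : ℝ), ∃ C p : ℝ, 0 < C ∧
      ∀ (E : Type) [Fintype E] [DecidableEq E] (ι : Type) [Fintype ι] (r : ι → E), Fintype.card ι ≤ n →
      ∀ S : (E → SU3) → ℝ, Continuous S →
        (∀ W W' : E → SU3, (∀ i, W (r i) = W' (r i)) → S W = S W') →
        (∀ (W : E → SU3) (i : ι) (A B : SU3) (s s' : ℝ),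
          |S (Function.update W (r i) (A * T s * B)) -
              S (Function.update W (r i) (A * T s' * B))| ≤ K * |s - s'|) →
        ∀ β : ℝ, 0 ≤ β → ∀ W : E → SU3,
          Real.exp (-(β * S W)) /
              (∫ W', Real.exp (-(β * S W')) ∂(Measure.pi fun _ : E => haarProbability SU3)) ≤
            C * (1 + β) ^ p := by
  intro T hT hW n K
  obtain ⟨d, V, hV⟩ := hW
  have hTc : Continuous T := continuous_of_coe_eq T hT
  have hTp : Function.Periodic T (2 * π) := periodic_of_coe_eq T hT
  -- the word map and its properties
  obtain ⟨word, hword⟩ : ∃ word : (Fin d → ℝ) → SU3,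
      ∀ s, word s = (List.ofFn fun j => V j * T (s j) * (V j)⁻¹).prod := ⟨_, fun _ => rfl⟩
  have hword_cont : Continuous word := by
    have : word = fun s => ((List.finRange d).map fun j => V j * T (s j) * (V j)⁻¹).prod := by
      funext s; rw [hword, List.ofFn_eq_map]
    rw [this]
    exact continuous_list_prod _ fun j _ =>
      (continuous_const.mul (hTc.comp (continuous_apply j))).mul continuous_const
  have hTmod : ∀ x, T (toIcoMod Real.two_pi_pos (-π) x) = T x := fun x => by
    rw [← self_sub_toIcoDiv_zsmul, hTp.sub_zsmul_eq]
  have hV' : ∀ g : SU3, ∃ s : Fin d → ℝ, (∀ j, -π ≤ s j ∧ s j ≤ π) ∧ word s = g := by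
    intro g
    obtain ⟨s, hs⟩ := hV g
    refine ⟨fun j => toIcoMod Real.two_pi_pos (-π) (s j), fun j => ?_, ?_⟩
    · have h := toIcoMod_mem_Ico Real.two_pi_pos (-π) (s j)
      exact ⟨h.1, by linarith [h.2]⟩
    · rw [hword, hs]
      simp only [hTmod]
  -- constants
  set K₁ : ℝ := max K 1 with hK₁
  have hK₁0 : 0 ≤ K₁ := le_trans zero_le_one (le_max_right K 1)
  have hKK₁ : K ≤ K₁ := le_max_left K 1
  set M : ℕ := n * d with hM
  set B : ℝ := 2 + 2 * π * K₁ * (M + 1) with hB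
  have hB2 : 2 ≤ B := by
    have : (0 : ℝ) ≤ 2 * π * K₁ * (M + 1) := by positivity
    rw [hB]; linarith
  refine ⟨Real.exp 1 * B ^ M, M, mul_pos (Real.exp_pos 1) (pow_pos (by linarith) M), ?_⟩
  intro E _ _ ι _ r hcard S hSc hdep hlip β hβ W
  classical
  -- translation elements
  obtain ⟨gθ, hgθ⟩ : ∃ gθ : (ι × Fin d → ℝ) → E → SU3, ∀ θ e, gθ θ e =
      if hx : ∃ i, r i = e then word (fun j => θ (Classical.choose hx, j)) else 1 :=
    ⟨fun θ e => if hx : ∃ i, r i = e then word (fun j => θ (Classical.choose hx, j)) else 1,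
      fun _ _ => rfl⟩
  have hg_cont : Continuous gθ := by
    refine continuous_pi fun e => ?_
    by_cases hx : ∃ i, r i = e
    · simp only [hgθ, dif_pos hx]
      exact hword_cont.comp (continuous_pi fun j => continuous_apply _)
    · simp only [hgθ, dif_neg hx]
      exact continuous_const
  -- the measure and the minimiser
  set μ : Measure (E → SU3) := Measure.pi fun _ => haarProbability SU3 with hμ
  haveI : IsProbabilityMeasure μ := by rw [hμ]; infer_instance
  haveI : μ.IsMulLeftInvariant := by rw [hμ]; infer_instance
  obtain ⟨W₁, -, hW₁⟩ := isCompact_univ.exists_isMinOn univ_nonempty hSc.continuousOn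
  have hmin : ∀ x, S W₁ ≤ S x := fun x => hW₁ (mem_univ x)
  -- constants of this instance
  set m : ℕ := Fintype.card (ι × Fin d) with hm
  have hmM : m ≤ M := by
    rw [hm, hM, Fintype.card_prod, Fintype.card_fin]; exact Nat.mul_le_mul_right d hcard
  have hm0 : (0 : ℝ) ≤ m := Nat.cast_nonneg m
  set D' : ℝ := π⁻¹ + (β + 1) * K₁ * (m + 1) with hD'
  have hD'pos : 0 < D' := by rw [hD']; positivity
  set h : ℝ := 1 / D' with hh
  have h0 : 0 < h := by rw [hh]; positivity
  have hπ : h ≤ π := by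
    rw [hh]
    calc 1 / D' ≤ 1 / π⁻¹ := one_div_le_one_div_of_le (inv_pos.2 Real.pi_pos)
          (by rw [hD']; linarith [show (0 : ℝ) ≤ (β + 1) * K₁ * (m + 1) by positivity])
      _ = π := by rw [one_div, inv_inv]
  have hβh : β * (K₁ * (m * h)) ≤ 1 := by
    have h1 : β * (K₁ * (m * h)) ≤ (β + 1) * K₁ * (m + 1) * h := by
      have : β * K₁ * m ≤ (β + 1) * K₁ * (m + 1) := by
        nlinarith [mul_nonneg hβ hK₁0, mul_nonneg hK₁0 hm0]
      calc β * (K₁ * (m * h)) = β * K₁ * m * h := by ring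
        _ ≤ (β + 1) * K₁ * (m + 1) * h := mul_le_mul_of_nonneg_right this h0.le
    have h2 : (β + 1) * K₁ * (m + 1) * h ≤ 1 := by
      rw [hh, mul_one_div, div_le_one hD'pos, hD']
      linarith [inv_pos.2 Real.pi_pos]
    exact h1.trans h2
  set c₀ : ℝ := Real.exp (-(β * S W₁) - 1) with hc₀
  -- the integrand
  have hexp_cont : Continuous fun W' : E → SU3 => Real.exp (-(β * S W')) :=
    Real.continuous_exp.comp ((continuous_const.mul hSc).neg)
  have hjoint : Measurable fun p : (ι × Fin d → ℝ) × (E → SU3) =>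
      ENNReal.ofReal (Real.exp (-(β * S (gθ p.1 * p.2)))) :=
    (ENNReal.continuous_ofReal.comp (hexp_cont.comp
      ((hg_cont.comp continuous_fst).mul continuous_snd))).measurable
  -- per-angle Lipschitz along the fibre
  have hlipθ : ∀ (W' : E → SU3) (θ : ι × Fin d → ℝ) (k : ι × Fin d) (t : ℝ),
      |S (gθ (Function.update θ k t) * W') - S (gθ θ * W')| ≤ K₁ * |t - θ k| := by
    intro W' θ k t
    obtain ⟨i, j⟩ := k
    have hex : ∃ i', r i' = r i := ⟨i, rfl⟩
    -- changing the angle `(i, j)` moves `gθ` only at `r i`, and only if `i` is the chosen preimage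
    have hoff : ∀ (y : ℝ) (e : E), (e = r i → Classical.choose hex ≠ i) →
        gθ (Function.update θ (i, j) y) e = gθ θ e := by
      intro y e he
      rw [hgθ, hgθ]
      by_cases hx : ∃ i', r i' = e
      · rw [dif_pos hx, dif_pos hx]
        congr 1
        funext j'
        refine Function.update_of_ne (fun hk => ?_) _ _
        have h1 : Classical.choose hx = i := (Prod.mk.inj hk).1
        have h2 := Classical.choose_spec hx
        rw [h1] at h2
        subst h2
        exact he rfl h1
      · rw [dif_neg hx, dif_neg hx]
    by_cases hsel : Classical.choose hex = i
    · obtain ⟨A, B', hAB⟩ := prod_ofFn_update d (fun j' => V j' * T (θ (i, j')) * (V j')⁻¹) j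
      have key : ∀ y, gθ (Function.update θ (i, j) y) * W' =
          Function.update (gθ θ * W') (r i) (A * V j * T y * ((V j)⁻¹ * B' * W' (r i))) := by
        intro y
        funext e
        by_cases he : e = r i
        · subst he
          rw [Function.update_self, Pi.mul_apply, hgθ, dif_pos hex, hsel,
            Function.update_comp_eq_of_injective' θ (Prod.mk_right_injective i) j y, hword]
          have : (fun j' => V j' * T (Function.update (fun j' => θ (i, j')) j y j') * (V j')⁻¹) =
              Function.update (fun j' => V j' * T (θ (i, j')) * (V j')⁻¹) j (V j * T y * (V j)⁻¹) :=
            funext fun j' => Function.apply_update (fun j' x => V j' * T x * (V j')⁻¹) _ j y j'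
          rw [this, hAB]
          simp only [mul_assoc]
        · rw [Function.update_of_ne he, Pi.mul_apply, Pi.mul_apply, hoff y e fun h => absurd h he]
      have e1 := key (θ (i, j))
      simp only [Function.update_eq_self] at e1
      rw [key t, e1, Function.update_idem]
      exact (hlip _ i _ _ _ _).trans (mul_le_mul_of_nonneg_right hKK₁ (abs_nonneg _))
    · rw [show gθ (Function.update θ (i, j) t) = gθ θ from funext fun e => hoff t e fun _ => hsel,
        sub_self, abs_zero]
      exact mul_nonneg hK₁0 (abs_nonneg _)
  -- every fibre reaches the minimiser, with angles in the box
  have honto : ∀ W' : E → SU3, ∃ θs ∈ Icc (fun _ : ι × Fin d => -π) (fun _ => π),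
      S (gθ θs * W') = S W₁ := by
    intro W'
    choose sf hsf_mem hsf_eq using hV'
    refine ⟨fun k => sf (W₁ (r k.1) * (W' (r k.1))⁻¹) k.2,
      ⟨fun k => (hsf_mem _ _).1, fun k => (hsf_mem _ _).2⟩, hdep _ _ fun i => ?_⟩
    have key : ∀ hx : ∃ i', r i' = r i,
        word (fun j => sf (W₁ (r (Classical.choose hx)) * (W' (r (Classical.choose hx)))⁻¹) j) *
          W' (r i) = W₁ (r i) := by
      intro hx
      rw [Classical.choose_spec hx, show (fun j => sf (W₁ (r i) * (W' (r i))⁻¹) j) =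
        sf (W₁ (r i) * (W' (r i))⁻¹) from rfl, hsf_eq, inv_mul_cancel_right]
    rw [Pi.mul_apply, hgθ, dif_pos ⟨i, rfl⟩]
    exact key _
  -- the fibre lower bound
  have hfibre : ∀ W' : E → SU3, ENNReal.ofReal (h ^ m) * ENNReal.ofReal c₀ ≤
      ∫⁻ θ in Icc (fun _ : ι × Fin d => -π) (fun _ => π),
        ENNReal.ofReal (Real.exp (-(β * S (gθ θ * W')))) := by
    intro W'
    obtain ⟨θs, hθs_box, hθs_S⟩ := honto W'
    rw [hm]
    refine cube_lintegral_bound θs hθs_box h0 hπ _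
      ((ENNReal.continuous_ofReal.comp (hexp_cont.comp (hg_cont.mul continuous_const))).measurable)
      _ fun θ hθ => ?_
    apply ENNReal.ofReal_le_ofReal
    apply Real.exp_le_exp.mpr
    have h1 : |S (gθ θ * W') - S (gθ θs * W')| ≤ K₁ * ∑ k, |θ k - θs k| :=
      abs_sub_le_mul_sum (fun θ => S (gθ θ * W')) (hlipθ W') θ θs
    have h2 : ∑ k, |θ k - θs k| ≤ m * h := by
      refine (Finset.sum_le_sum fun k _ => hθ k).trans ?_
      rw [Finset.sum_const, Finset.card_univ, nsmul_eq_mul, hm]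
    have h3 : S (gθ θ * W') ≤ S W₁ + K₁ * (m * h) := by
      rw [← hθs_S]
      linarith [le_abs_self (S (gθ θ * W') - S (gθ θs * W')), mul_le_mul_of_nonneg_left h2 hK₁0]
    have h4 : β * S (gθ θ * W') ≤ β * S W₁ + 1 := by
      have := mul_le_mul_of_nonneg_left h3 hβ
      rw [mul_add] at this
      linarith
    show -(β * S W₁) - 1 ≤ -(β * S (gθ θ * W'))
    linarith
  -- averaging: the coupling
  have havg := le_lintegral_of_fibre μ
    ((volume : Measure (ι × Fin d → ℝ)).restrict (Icc (fun _ : ι × Fin d => -π) (fun _ => π)))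
    gθ (fun W' => ENNReal.ofReal (Real.exp (-(β * S W')))) hjoint _ hfibre
  rw [Measure.restrict_apply_univ, Real.volume_Icc_pi] at havg
  simp only [sub_neg_eq_add, Finset.prod_const, Finset.card_univ] at havg
  rw [← hm, ← ENNReal.ofReal_pow (by positivity), ← ofReal_integral_eq_lintegral_ofReal
    (TiltedFlatnessNegative.integrable_of_continuous hexp_cont)
    (ae_of_all _ fun _ => (Real.exp_pos _).le), ← ENNReal.ofReal_mul (by positivity),
    ← ENNReal.ofReal_mul (by positivity)] at havg
  set Z : ℝ := ∫ W', Real.exp (-(β * S W')) ∂μ with hZ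
  have hZ0 : 0 ≤ Z := integral_nonneg fun _ => (Real.exp_pos _).le
  have hreal : h ^ m * c₀ ≤ (π + π) ^ m * Z :=
    (ENNReal.ofReal_le_ofReal_iff (by positivity)).1 havg
  have hc₀pos : 0 < c₀ := Real.exp_pos _
  have hZpos : 0 < Z :=
    pos_of_mul_pos_right ((mul_pos (pow_pos h0 m) hc₀pos).trans_le hreal) (by positivity)
  -- conclusion
  rw [Real.rpow_natCast, div_le_iff₀ hZpos]
  have hq : (π + π) / h = 2 + 2 * π * (β + 1) * K₁ * (m + 1) := by
    rw [hh, hD']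
    field_simp
    ring
  have hle : (π + π) / h ≤ (1 + β) * B := by
    rw [hq, hB]
    have hmM' : (m : ℝ) + 1 ≤ M + 1 := by exact_mod_cast Nat.succ_le_succ hmM
    have : 2 * π * (β + 1) * K₁ * (m + 1) ≤ 2 * π * (β + 1) * K₁ * (M + 1) :=
      mul_le_mul_of_nonneg_left hmM' (by positivity)
    nlinarith
  have hkey : ((π + π) / h) ^ m ≤ ((1 + β) * B) ^ M :=
    (pow_le_pow_left₀ (by positivity) hle m).trans
      (pow_le_pow_right₀ (one_le_mul_of_one_le_of_one_le (by linarith) (by linarith)) hmM)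
  calc Real.exp (-(β * S W)) ≤ Real.exp (-(β * S W₁)) :=
        Real.exp_le_exp.2 (neg_le_neg (mul_le_mul_of_nonneg_left (hmin W) hβ))
    _ = Real.exp 1 * c₀ := by rw [hc₀, ← Real.exp_add]; congr 1; ring
    _ ≤ Real.exp 1 * (((π + π) / h) ^ m * Z) := by
        refine mul_le_mul_of_nonneg_left ?_ (Real.exp_pos 1).le
        rw [div_pow, div_mul_eq_mul_div, le_div_iff₀ (pow_pos h0 m)]
        linarith
    _ ≤ Real.exp 1 * (((1 + β) * B) ^ M * Z) :=
        mul_le_mul_of_nonneg_left (mul_le_mul_of_nonneg_right hkey hZ0) (Real.exp_pos 1).le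
    _ = Real.exp 1 * B ^ M * (1 + β) ^ M * Z := by rw [mul_pow]; ring

end Summit.QuantumFields.QCD.Theorems.CircleTransport
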